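import Mathlib
import Literature.Probability.Percolation.PercolationProofs
import Literature.Probability.LatticeModels.ProdBernoulliIndependence
import Literature.Probability.LatticeModels.ProdBernoulliClusterLocality
import Literature.Probability.LatticeModels.ProdBernoulliCoupling
import Literature.Probability.Percolation.KozmaNitzanPinning
import Summits.CriticalPhenomena.PercolationContinuityZ3.Theorems.PercNearOneGluingAdditiveGluingGoodStep24Peel
import HarnessLib

/-! # Crux `PercNearOneGluing.AdditiveGluing` (stmt-CriticalPhenomena-4576), line `subuniform-dead-pocket-maximum`, stub `stub_goodStep` — reduction to a LOW-ONLY observer (siege k24)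

Support file for the inductive step `stub_goodStep` of the skeleton
`Cruxes/AdditiveGluing/Lines/subuniform-dead-pocket-maximum.lean`; proves the registered helper stub
`stub_goodStepLowOnly_k24` and lands `--supports stmt-CriticalPhenomena-4576`.

## Content

`GOOD(w, A, o, b)` denotes Kozma–Nitzan goodness (arXiv:2401.12397 §3.2 p. 12) in the skeleton's
linear selection form: for every level `t` with `1 − t ≤ μ_w(a ↔ b)` on `A` and every selection
`sel W ∈ A`,
`μ_w(o ↔ A, o ↮ b) + Σ_{W ∋ o, W ∩ A = ∅} μ_w(C(o) = W) · μ_w((sel W ↔ b in Wᶜ)ᶜ) ≤ t`.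

**Theorem (`stub_goodStepLowOnly_k24`).**  Let `b ∈ A ∌ o` and let `wᴬ = w` with every pair
`o–a`, `a ∈ A`, given weight `0` (the observer keeps only its LOW pairs).  Then
`GOOD(wᴬ, A, o, b) ⟹ GOOD(w, A, o, b)`.

So the inductive step only ever has to be proved for observers none of whose positive-weight
neighbours is a relay.  Proof (siege k24 NOTES §Plan (2)):
* `â :=` a minimiser of `μ_{wᴬ}(· ↔ b)` over `A`; the summed PEELING lemma
  (`goodStep24_peel_sum`, file `…GoodStep24Peel.lean`, = KN Lemma 5 keeping the low star, summed
  over the patterns of the high star) gives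
  `μ_w(â ↔ b) ≤ μ_w(o ↔ b) + μ_w(σ_∅) · (μ_{wᴬ}(â ↔ b) − μ_{wᴬ}(o ↔ b))`, `σ_∅ = {no pair o–A open}`;
* bookkeeping identities, for `u ∈ {w, wᴬ}`: `μ_u(o ↔ A, o ↮ b) = μ_u(o ↔ A) − μ_u(o ↔ b)` and
  `μ_u(o ↔ A) + Σ_{W dead} μ_u(C(o) = W) = 1` (the dead pockets partition `{o ↮ A}`), so that the
  goodness functional is `1 − μ_u(o ↔ b) − Σ_W μ_u(C(o) = W) · μ_u(sel W ↔ b in Wᶜ)`;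
* `GOOD(wᴬ)` at its own tightest level `t = 1 − μ_{wᴬ}(â ↔ b)`;
* `μ_{wᴬ}(x ↔ b in Wᶜ) = μ_w(x ↔ b in Wᶜ)` for `W ∋ o` (the event lives on pairs inside `Wᶜ`,
  where the two weightings agree), and `μ_w(σ_∅) · μ_{wᴬ}(C(o) = W) = μ_w(σ_∅ ∩ {C(o) = W}) ≤
  μ_w(C(o) = W)` (conditioning on `σ_∅` is pinning the high star closed:
  `prodBernoulli_real_inter_localCylinder` with the empty pattern).
Chaining: `t ≥ 1 − μ_w(â ↔ b) ≥ 1 − μ_w(o ↔ b) − μ_w(σ_∅)·Σ_W μ_{wᴬ}(C=W) μ(sel W ↔ b in Wᶜ)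
≥ 1 − μ_w(o ↔ b) − Σ_W μ_w(C=W) μ(sel W ↔ b in Wᶜ)` = the goodness functional of `w`.
No new definitions.
-/

namespace Summit.CriticalPhenomena.PercolationContinuityZ3.Theorems

open MeasureTheory Set
open Literature.Probability.LatticeModels (prodBernoulli)
open Literature.Probability.Percolation (BondConfig openConn openConnIn openGraph openCluster)
open scoped BigOperators

noncomputable section
open Classical

section GoodStep24LowOnlyAux

open Filter
open Literature.Probability.LatticeModels Literature.Probability.Percolation

variable {n : ℕ}

/-- **The dead pockets partition `{o ↮ A}`**: for `o ∉ A` and any weighting `u`,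
`μ_u(o ↔ A) + Σ_{W ∋ o, W ∩ A = ∅} μ_u(C(o) = W) = 1`. [folklore] -/
theorem goodStep24_partition (u : Sym2 (Fin n) → unitInterval) (A : Finset (Fin n)) (o : Fin n) :
    (prodBernoulli u).real (⋃ a ∈ A, openConn o a) +
      ∑ W ∈ (Finset.univ : Finset (Finset (Fin n))).filter (fun W => o ∈ W ∧ Disjoint W A),
        (prodBernoulli u).real {ω : BondConfig (Fin n) | openCluster ω o = (W : Set (Fin n))} = 1 := by
  set Fl := (Finset.univ : Finset (Finset (Fin n))).filter (fun W => o ∈ W ∧ Disjoint W A) with hFl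
  have hmemFl : ∀ W, W ∈ Fl ↔ o ∈ W ∧ Disjoint W A := fun W => by simp [hFl]
  have hdec : (⋃ a ∈ A, openConn o a : Set (BondConfig (Fin n)))ᶜ =
      ⋃ W ∈ Fl, {ω : BondConfig (Fin n) | openCluster ω o = (W : Set (Fin n))} := by
    ext ω
    simp only [Set.mem_compl_iff, Set.mem_iUnion, Set.mem_setOf_eq, not_exists]
    constructor
    · intro hω
      refine ⟨(Set.toFinite (openCluster ω o)).toFinset, (hmemFl _).2 ⟨?_, ?_⟩, ?_⟩
      · exact (Set.Finite.mem_toFinset _).2 (mem_openCluster_self ω o)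
      · rw [Finset.disjoint_left]
        intro a ha haA
        have ha' : a ∈ openCluster ω o := (Set.toFinite (openCluster ω o)).mem_toFinset.1 ha
        exact hω a haA ha'
      · exact (Set.Finite.coe_toFinset _).symm
    · rintro ⟨W, hW, hωW⟩ a haA hoa
      have hoa' : a ∈ openCluster ω o := hoa
      rw [hωW] at hoa'
      exact Finset.disjoint_left.1 ((hmemFl W).1 hW).2 (Finset.mem_coe.1 hoa') haA
  have hdisj : (↑Fl : Set (Finset (Fin n))).PairwiseDisjoint
      fun W => {ω : BondConfig (Fin n) | openCluster ω o = (W : Set (Fin n))} := by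
    intro W _ W' _ hne
    rw [Function.onFun, Set.disjoint_left]
    intro ω h h'
    exact hne (Finset.coe_injective (h.symm.trans h'))
  have hc := measureReal_add_measureReal_compl (μ := prodBernoulli u)
    (s := ⋃ a ∈ A, (openConn o a : Set (BondConfig (Fin n)))) MeasurableSet.of_discrete
  rw [hdec, measureReal_biUnion_finset hdisj fun _ _ => MeasurableSet.of_discrete, probReal_univ] at hc
  exact hc

/-- The goodness functional in closed form: for `b ∈ A ∌ o`, any weighting `u` and any selection,
`μ_u(o ↔ A, o ↮ b) + Σ_W μ_u(C(o)=W)·μ_u((sel W ↔ b in Wᶜ)ᶜ)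
 = 1 − μ_u(o ↔ b) − Σ_W μ_u(C(o)=W)·μ_u(sel W ↔ b in Wᶜ)`. [folklore] -/
theorem goodStep24_functional_eq (u : Sym2 (Fin n) → unitInterval) (A : Finset (Fin n))
    (o b : Fin n) (hb : b ∈ A) (sel : Finset (Fin n) → Fin n) :
    (prodBernoulli u).real ((⋃ a ∈ A, openConn o a) ∩ (openConn o b)ᶜ)
      + ∑ W ∈ (Finset.univ : Finset (Finset (Fin n))).filter (fun W => o ∈ W ∧ Disjoint W A),
          (prodBernoulli u).real {ω : BondConfig (Fin n) | openCluster ω o = (W : Set (Fin n))}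
            * (prodBernoulli u).real (openConnIn ((W : Set (Fin n))ᶜ) (sel W) b)ᶜ =
    1 - (prodBernoulli u).real (openConn o b)
      - ∑ W ∈ (Finset.univ : Finset (Finset (Fin n))).filter (fun W => o ∈ W ∧ Disjoint W A),
          (prodBernoulli u).real {ω : BondConfig (Fin n) | openCluster ω o = (W : Set (Fin n))}
            * (prodBernoulli u).real (openConnIn ((W : Set (Fin n))ᶜ) (sel W) b) := by
  have hpart := goodStep24_partition u A o
  -- live failure = `μ(o ↔ A) − μ(o ↔ b)`
  have hsub : (openConn o b : Set (BondConfig (Fin n))) ⊆ ⋃ a ∈ A, openConn o a :=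
    fun ω hω => Set.mem_iUnion₂.2 ⟨b, hb, hω⟩
  have hlive : (prodBernoulli u).real ((⋃ a ∈ A, openConn o a) ∩ (openConn o b)ᶜ) =
      (prodBernoulli u).real (⋃ a ∈ A, openConn o a) - (prodBernoulli u).real (openConn o b) := by
    have h := measureReal_inter_add_sdiff (μ := prodBernoulli u)
      (s := ⋃ a ∈ A, (openConn o a : Set (BondConfig (Fin n)))) (t := openConn o b)
      (h := measure_ne_top _ _) MeasurableSet.of_discrete
    rw [Set.inter_eq_right.2 hsub, Set.sdiff_eq] at h
    linarith
  -- complements inside the sum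
  have hcompl : ∀ W : Finset (Fin n),
      (prodBernoulli u).real (openConnIn ((W : Set (Fin n))ᶜ) (sel W) b)ᶜ =
        1 - (prodBernoulli u).real (openConnIn ((W : Set (Fin n))ᶜ) (sel W) b) := fun W =>
    probReal_compl_eq_one_sub MeasurableSet.of_discrete
  simp only [hcompl, mul_sub, mul_one, Finset.sum_sub_distrib]
  rw [hlive]
  linarith

/-- Connection inside `Wᶜ`, `W ∋ o`, does not see the pairs at `o`: if `u` and `u'` agree off the
pairs `o–h`, `h ∈ H`, then `μ_u(x ↔ b in Wᶜ) = μ_{u'}(x ↔ b in Wᶜ)` for every `W ∋ o`.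
[folklore] -/
theorem goodStep24_real_openConnIn_eq (u u' : Sym2 (Fin n) → unitInterval) (o : Fin n)
    (H W : Finset (Fin n)) (hoW : o ∈ W) (x b : Fin n)
    (h : ∀ e, (¬ ∃ h ∈ H, s(o, h) = e) → u e = u' e) :
    (prodBernoulli u).real (openConnIn ((W : Set (Fin n))ᶜ) x b) =
      (prodBernoulli u').real (openConnIn ((W : Set (Fin n))ᶜ) x b) := by
  refine prodBernoulli_real_eq_of_determinedBy u u' (F := ((W : Set (Fin n))ᶜ).sym2) ?_
    (DCT16.determinedBy_openConnIn _ x b subset_rfl) MeasurableSet.of_discrete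
  intro e he
  refine h e ?_
  rintro ⟨h', _, rfl⟩
  have := Set.mk_mem_sym2_iff.1 he
  exact this.1 (Finset.mem_coe.2 hoW)

end GoodStep24LowOnlyAux

open Filter Literature.Probability.LatticeModels Literature.Probability.Percolation in
/-- Registered helper stub `stub_goodStepLowOnly_k24` of crux stmt-CriticalPhenomena-4576 (siege
k24, for `stub_goodStep`): **goodness of an observer follows from goodness of the same observer
with its pairs into the relay set killed.**  With `wᴬ = w` except weight `0` on every pair `o–a`,
`a ∈ A`: `GOOD(wᴬ, A, o, b) → GOOD(w, A, o, b)` (both in the skeleton's selection form, for all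
levels and selections).  See the module docstring for the proof (summed peeling lemma + dead-pocket
bookkeeping). [cite: KozmaNitzan2024, §3.2 (Lemma 5 and the proof of Thm 4, pp. 12–14)] -/
theorem stub_goodStepLowOnly_k24 :
    ∀ (n : ℕ) (w : Sym2 (Fin n) → unitInterval) (A : Finset (Fin n)) (o b : Fin n),
      b ∈ A → o ∉ A →
      (∀ (t : ℝ) (sel : Finset (Fin n) → Fin n), (∀ W, sel W ∈ A) →
        (∀ a ∈ A, 1 - t ≤ (prodBernoulli (fun e : Sym2 (Fin n) =>
            if (∃ h ∈ A, s(o, h) = e) then 0 else w e)).real (openConn a b)) →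
        (prodBernoulli (fun e : Sym2 (Fin n) => if (∃ h ∈ A, s(o, h) = e) then 0 else w e)).real
            ((⋃ a ∈ A, openConn o a) ∩ (openConn o b)ᶜ)
          + ∑ W ∈ (Finset.univ : Finset (Finset (Fin n))).filter (fun W => o ∈ W ∧ Disjoint W A),
              (prodBernoulli (fun e : Sym2 (Fin n) =>
                  if (∃ h ∈ A, s(o, h) = e) then 0 else w e)).real
                  {ω : BondConfig (Fin n) | openCluster ω o = (W : Set (Fin n))}
                * (prodBernoulli (fun e : Sym2 (Fin n) =>
                    if (∃ h ∈ A, s(o, h) = e) then 0 else w e)).real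
                    (openConnIn ((W : Set (Fin n))ᶜ) (sel W) b)ᶜ
          ≤ t) →
      ∀ (t : ℝ) (sel : Finset (Fin n) → Fin n), (∀ W, sel W ∈ A) →
        (∀ a ∈ A, 1 - t ≤ (prodBernoulli w).real (openConn a b)) →
        (prodBernoulli w).real ((⋃ a ∈ A, openConn o a) ∩ (openConn o b)ᶜ)
          + ∑ W ∈ (Finset.univ : Finset (Finset (Fin n))).filter (fun W => o ∈ W ∧ Disjoint W A),
              (prodBernoulli w).real {ω : BondConfig (Fin n) | openCluster ω o = (W : Set (Fin n))}
                * (prodBernoulli w).real (openConnIn ((W : Set (Fin n))ᶜ) (sel W) b)ᶜ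
          ≤ t := by
  intro n w A o b hb ho hL t sel hsel ht
  set wA : Sym2 (Fin n) → unitInterval :=
    fun e => if (∃ h ∈ A, s(o, h) = e) then 0 else w e with hwA
  set Fl := (Finset.univ : Finset (Finset (Fin n))).filter (fun W => o ∈ W ∧ Disjoint W A) with hFl
  have hmemFl : ∀ W, W ∈ Fl ↔ o ∈ W ∧ Disjoint W A := fun W => by simp [hFl]
  have hbo : b ≠ o := fun h => ho (h ▸ hb)
  -- the minimiser `â` of `μ_{wᴬ}(· ↔ b)` over `A`
  obtain ⟨â, hâ, hmin⟩ :=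
    Finset.exists_min_image A (fun a => (prodBernoulli wA).real (openConn a b)) ⟨b, hb⟩
  -- goodness of `wᴬ` at its tightest level
  have hGL := hL (1 - (prodBernoulli wA).real (openConn â b)) sel hsel
    (fun a ha => by linarith [hmin a ha])
  rw [goodStep24_functional_eq wA A o b hb sel] at hGL
  rw [goodStep24_functional_eq w A o b hb sel]
  -- the summed peeling lemma with `H = A`
  have hpeel := goodStep24_peel_sum n w o b â A hbo ho (fun h hh => hmin h hh)
  -- the level at `â`
  have htâ := ht â hâ
  -- `μ_{wᴬ}(x ↔ b in Wᶜ) = μ_w(x ↔ b in Wᶜ)` on dead pockets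
  have hin : ∀ W ∈ Fl, (prodBernoulli wA).real (openConnIn ((W : Set (Fin n))ᶜ) (sel W) b) =
      (prodBernoulli w).real (openConnIn ((W : Set (Fin n))ᶜ) (sel W) b) := by
    intro W hW
    refine goodStep24_real_openConnIn_eq wA w o A W ((hmemFl W).1 hW).1 (sel W) b ?_
    intro e he
    simp only [hwA]
    rw [if_neg he]
  -- `μ_w(σ_∅) · μ_{wᴬ}(C(o) = W) ≤ μ_w(C(o) = W)`
  obtain ⟨F, hF⟩ := goodStep24_exists_highStar o A
  have hpin0 : pinW w (↑F : Set (Sym2 (Fin n))) ↑(∅ : Finset (Sym2 (Fin n))) = wA := by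
    funext e
    rw [pinW_apply]
    by_cases he : e ∈ (↑F : Set (Sym2 (Fin n)))
    · have he' : ∃ h ∈ A, s(o, h) = e := (hF e).1 he
      simp only [hwA]
      rw [if_pos he, if_pos he', Finset.coe_empty, if_neg (Set.notMem_empty e)]
    · have he' : ¬ ∃ h ∈ A, s(o, h) = e := fun h => he ((hF e).2 h)
      simp only [hwA]
      rw [if_neg he, if_neg he']
  have hcyl0 : localCylinder (↑F : Set (Sym2 (Fin n))) ↑(∅ : Finset (Sym2 (Fin n))) =
      {ω : BondConfig (Fin n) | ∀ h ∈ A, s(o, h) ∉ ω} := by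
    ext ω
    simp only [localCylinder, Finset.coe_empty, Set.mem_empty_iff_false, iff_false,
      Set.mem_setOf_eq]
    constructor
    · intro hω h hh
      exact hω _ ((hF _).2 ⟨h, hh, rfl⟩)
    · intro hω e he
      obtain ⟨h, hh, rfl⟩ := (hF e).1 he
      exact hω h hh
  have hpock : ∀ W ∈ Fl,
      (prodBernoulli w).real {ω : BondConfig (Fin n) | ∀ h ∈ A, s(o, h) ∉ ω} *
          (prodBernoulli wA).real {ω : BondConfig (Fin n) | openCluster ω o = (W : Set (Fin n))} ≤
        (prodBernoulli w).real {ω : BondConfig (Fin n) | openCluster ω o = (W : Set (Fin n))} := by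
    intro W _
    have h := prodBernoulli_real_inter_localCylinder w F (↑(∅ : Finset (Sym2 (Fin n))))
      (A := {ω : BondConfig (Fin n) | openCluster ω o = (W : Set (Fin n))}) MeasurableSet.of_discrete
    rw [hpin0, hcyl0] at h
    rw [← h]
    exact measureReal_mono Set.inter_subset_left (measure_ne_top _ _)
  -- assemble: compare the two pocket sums termwise
  have hsum : (prodBernoulli w).real {ω : BondConfig (Fin n) | ∀ h ∈ A, s(o, h) ∉ ω} *
      ∑ W ∈ Fl, (prodBernoulli wA).real {ω : BondConfig (Fin n) | openCluster ω o = (W : Set (Fin n))}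
          * (prodBernoulli wA).real (openConnIn ((W : Set (Fin n))ᶜ) (sel W) b) ≤
      ∑ W ∈ Fl, (prodBernoulli w).real {ω : BondConfig (Fin n) | openCluster ω o = (W : Set (Fin n))}
          * (prodBernoulli w).real (openConnIn ((W : Set (Fin n))ᶜ) (sel W) b) := by
    rw [Finset.mul_sum]
    refine Finset.sum_le_sum fun W hW => ?_
    rw [hin W hW, ← mul_assoc]
    exact mul_le_mul_of_nonneg_right (hpock W hW) measureReal_nonneg
  have hσ0 : 0 ≤ (prodBernoulli w).real {ω : BondConfig (Fin n) | ∀ h ∈ A, s(o, h) ∉ ω} :=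
    measureReal_nonneg
  nlinarith [hGL, hpeel, htâ, hsum, hσ0]

end

end Summit.CriticalPhenomena.PercolationContinuityZ3.Theorems
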